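import Mathlib
import Summits.Ventures.PercRepro.TriangleCapSevenElevenF

/-!
# PercRepro — towards the cell `(7, 11)`: configuration β of the three-triangle case (p3, gen 35; part 35m)

* `three_of_three` — three distinct elements of a three-element set exhaust it;
* `third_vertex` — the third vertex of a triangle;
* `shared_unique` — two distinct triangles of a `K₄⁻`-free graph share at most one vertex;
* `no_edge_f3` — three triangles through one vertex on `7` vertices admit no further edge: `2m ≤ 18`;
* **`beta_bound`** — `y` in the first triangle, `x, z` off the first two, `m ≥ 11`: `Σ₀ ≥ 4`.

Axioms: standard.
-/

namespace PercRepro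

namespace TriangleCap

namespace C047

open Finset

variable {V : Type*} [Fintype V] [DecidableEq V]

omit [Fintype V] [DecidableEq V] in
/-- Three distinct elements of a three-element set exhaust it. -/
theorem three_of_three {a b c s t p : V} (hs : s = a ∨ s = b ∨ s = c) (ht : t = a ∨ t = b ∨ t = c)
    (hp : p = a ∨ p = b ∨ p = c) (hst : s ≠ t) (hsp : s ≠ p) (htp : t ≠ p) :
    (a = s ∨ a = t ∨ a = p) ∧ (b = s ∨ b = t ∨ b = p) ∧ (c = s ∨ c = t ∨ c = p) := by
  rcases hs with rfl | rfl | rfl <;> rcases ht with rfl | rfl | rfl <;> rcases hp with rfl | rfl | rfl <;>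
    simp_all

omit [Fintype V] [DecidableEq V] in
/-- The third vertex of a triangle. -/
theorem third_vertex {p q r s t : V} (hpq : p ≠ q) (hpr : p ≠ r) (hqr : q ≠ r)
    (hs : s = p ∨ s = q ∨ s = r) (ht : t = p ∨ t = q ∨ t = r) (hst : s ≠ t) :
    ∃ x, (x = p ∨ x = q ∨ x = r) ∧ x ≠ s ∧ x ≠ t := by
  rcases hs with rfl | rfl | rfl <;> rcases ht with rfl | rfl | rfl
  · exact (hst rfl).elim
  · exact ⟨r, by simp, hpr.symm, hqr.symm⟩
  · exact ⟨q, by simp, hpq.symm, hqr⟩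
  · exact ⟨r, by simp, hqr.symm, hpr.symm⟩
  · exact (hst rfl).elim
  · exact ⟨p, by simp, hpq, hpr⟩
  · exact ⟨q, by simp, hqr, hpq.symm⟩
  · exact ⟨p, by simp, hpr, hpq⟩
  · exact (hst rfl).elim

/-- Two distinct triangles of a `K₄⁻`-free graph share at most one vertex. -/
theorem shared_unique (D : SimpleGraph V) [DecidableRel D.Adj] (hK : K4mFree D) {u v w a b c : V}
    (huv : D.Adj u v) (huw : D.Adj u w) (hvw : D.Adj v w) (hab : D.Adj a b) (hac : D.Adj a c)
    (hbc : D.Adj b c) (hne : ∃ t, (t = a ∨ t = b ∨ t = c) ∧ ¬ (t = u ∨ t = v ∨ t = w)) {s t : V}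
    (hs1 : s = u ∨ s = v ∨ s = w) (hs2 : s = a ∨ s = b ∨ s = c) (ht1 : t = u ∨ t = v ∨ t = w)
    (ht2 : t = a ∨ t = b ∨ t = c) (hst : s ≠ t) : False := by
  obtain ⟨p₁, hp₁, hp₁s, hp₁t⟩ := third_vertex huv.ne huw.ne hvw.ne hs1 ht1 hst
  obtain ⟨p₂, hp₂, hp₂s, hp₂t⟩ := third_vertex hab.ne hac.ne hbc.ne hs2 ht2 hst
  have hp : p₁ ≠ p₂ := by
    rintro rfl
    obtain ⟨e, he2, he1⟩ := hne
    -- the three distinct vertices `s, t, p₁` of the second triangle exhaust it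
    have hall := three_of_three hs2 ht2 hp₂ hst (Ne.symm hp₂s) (Ne.symm hp₂t)
    have he' : e = s ∨ e = t ∨ e = p₁ := by
      rcases he2 with rfl | rfl | rfl
      · exact hall.1
      · exact hall.2.1
      · exact hall.2.2
    rcases he' with rfl | rfl | rfl
    · exact he1 hs1
    · exact he1 ht1
    · exact he1 hp₁
  have h1 := adj_of_mem_triangle D huv huw hvw hs1 ht1 hst
  have h2 := adj_of_mem_triangle D huv huw hvw hs1 hp₁ (Ne.symm hp₁s)
  have h3 := adj_of_mem_triangle D huv huw hvw ht1 hp₁ (Ne.symm hp₁t)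
  have h4 := adj_of_mem_triangle D hab hac hbc hs2 hp₂ (Ne.symm hp₂s)
  have h5 := adj_of_mem_triangle D hab hac hbc ht2 hp₂ (Ne.symm hp₂t)
  exact not_adj_both D hK h1 h2 h3 hp h4 h5

/-- **THREE TRIANGLES THROUGH ONE VERTEX ON SEVEN VERTICES ADMIT NO FURTHER EDGE:** `2m ≤ 18`. -/
theorem no_edge_f3 (D : SimpleGraph V) [DecidableRel D.Adj] (hK : K4mFree D) (hk : Fintype.card V = 7)
    {s p p' q q' x z : V} (hsp : D.Adj s p) (hsp' : D.Adj s p') (hpp' : D.Adj p p') (hsq : D.Adj s q)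
    (hsq' : D.Adj s q') (hqq' : D.Adj q q') (hsx : D.Adj s x) (hsz : D.Adj s z) (hxz : D.Adj x z)
    (hpq : p ≠ q) (hpq' : p ≠ q') (hp'q : p' ≠ q) (hp'q' : p' ≠ q') (hpx : p ≠ x) (hpz : p ≠ z)
    (hp'x : p' ≠ x) (hp'z : p' ≠ z) (hqx : q ≠ x) (hqz : q ≠ z) (hq'x : q' ≠ x) (hq'z : q' ≠ z)
    (h7 : ∀ t : V, t = s ∨ t = p ∨ t = p' ∨ t = q ∨ t = q' ∨ t = x ∨ t = z) :
    2 * D.edgeFinset.card ≤ 18 := by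
  -- a vertex of one triangle is adjacent to no vertex of another (other than `s`)
  have key : ∀ t t' r : V, D.Adj s t → D.Adj s t' → D.Adj t t' → t' ≠ r →
      D.Adj s r → D.Adj t r → False :=
    fun t t' r h1 h2 h3 h6 h7' h8 => not_adj_both D hK h1 h2 h3 h6 h7' h8
  have hdeg : ∀ t, deg D t ≤ if t = s then 6 else 2 := by
    intro t
    rcases h7 t with rfl | rfl | rfl | rfl | rfl | rfl | rfl
    · rw [if_pos rfl]
      have := deg_le_card_sub_one D t
      omega
    · rw [if_neg hsp.ne.symm]
      refine le_trans (deg_le_of_subset D t ({s, p'} : Finset V) ?_) card_le_two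
      intro r hr
      simp only [mem_insert, mem_singleton]
      rcases h7 r with rfl | rfl | rfl | rfl | rfl | rfl | rfl
      · exact Or.inl rfl
      · exact (hr.ne rfl).elim
      · exact Or.inr rfl
      · exact (key t p' r hsp hsp' hpp' hp'q hsq hr).elim
      · exact (key t p' r hsp hsp' hpp' hp'q' hsq' hr).elim
      · exact (key t p' r hsp hsp' hpp' hp'x hsx hr).elim
      · exact (key t p' r hsp hsp' hpp' hp'z hsz hr).elim
    · rw [if_neg hsp'.ne.symm]
      refine le_trans (deg_le_of_subset D t ({s, p} : Finset V) ?_) card_le_two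
      intro r hr
      simp only [mem_insert, mem_singleton]
      rcases h7 r with rfl | rfl | rfl | rfl | rfl | rfl | rfl
      · exact Or.inl rfl
      · exact Or.inr rfl
      · exact (hr.ne rfl).elim
      · exact (key t p r hsp' hsp hpp'.symm hpq hsq hr).elim
      · exact (key t p r hsp' hsp hpp'.symm hpq' hsq' hr).elim
      · exact (key t p r hsp' hsp hpp'.symm hpx hsx hr).elim
      · exact (key t p r hsp' hsp hpp'.symm hpz hsz hr).elim
    · rw [if_neg hsq.ne.symm]
      refine le_trans (deg_le_of_subset D t ({s, q'} : Finset V) ?_) card_le_two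
      intro r hr
      simp only [mem_insert, mem_singleton]
      rcases h7 r with rfl | rfl | rfl | rfl | rfl | rfl | rfl
      · exact Or.inl rfl
      · exact (key t q' r hsq hsq' hqq' (Ne.symm hpq') hsp hr).elim
      · exact (key t q' r hsq hsq' hqq' (Ne.symm hp'q') hsp' hr).elim
      · exact (hr.ne rfl).elim
      · exact Or.inr rfl
      · exact (key t q' r hsq hsq' hqq' hq'x hsx hr).elim
      · exact (key t q' r hsq hsq' hqq' hq'z hsz hr).elim
    · rw [if_neg hsq'.ne.symm]
      refine le_trans (deg_le_of_subset D t ({s, q} : Finset V) ?_) card_le_two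
      intro r hr
      simp only [mem_insert, mem_singleton]
      rcases h7 r with rfl | rfl | rfl | rfl | rfl | rfl | rfl
      · exact Or.inl rfl
      · exact (key t q r hsq' hsq hqq'.symm (Ne.symm hpq) hsp hr).elim
      · exact (key t q r hsq' hsq hqq'.symm (Ne.symm hp'q) hsp' hr).elim
      · exact Or.inr rfl
      · exact (hr.ne rfl).elim
      · exact (key t q r hsq' hsq hqq'.symm hqx hsx hr).elim
      · exact (key t q r hsq' hsq hqq'.symm hqz hsz hr).elim
    · rw [if_neg hsx.ne.symm]
      refine le_trans (deg_le_of_subset D t ({s, z} : Finset V) ?_) card_le_two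
      intro r hr
      simp only [mem_insert, mem_singleton]
      rcases h7 r with rfl | rfl | rfl | rfl | rfl | rfl | rfl
      · exact Or.inl rfl
      · exact (key t z r hsx hsz hxz (Ne.symm hpz) hsp hr).elim
      · exact (key t z r hsx hsz hxz (Ne.symm hp'z) hsp' hr).elim
      · exact (key t z r hsx hsz hxz (Ne.symm hqz) hsq hr).elim
      · exact (key t z r hsx hsz hxz (Ne.symm hq'z) hsq' hr).elim
      · exact (hr.ne rfl).elim
      · exact Or.inr rfl
    · rw [if_neg hsz.ne.symm]
      refine le_trans (deg_le_of_subset D t ({s, x} : Finset V) ?_) card_le_two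
      intro r hr
      simp only [mem_insert, mem_singleton]
      rcases h7 r with rfl | rfl | rfl | rfl | rfl | rfl | rfl
      · exact Or.inl rfl
      · exact (key t x r hsz hsx hxz.symm (Ne.symm hpx) hsp hr).elim
      · exact (key t x r hsz hsx hxz.symm (Ne.symm hp'x) hsp' hr).elim
      · exact (key t x r hsz hsx hxz.symm (Ne.symm hqx) hsq hr).elim
      · exact (key t x r hsz hsx hxz.symm (Ne.symm hq'x) hsq' hr).elim
      · exact Or.inr rfl
      · exact (hr.ne rfl).elim
  have hsum := sum_le_sum (fun t (_ : t ∈ univ) => hdeg t)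
  rw [sum_deg_eq] at hsum
  have e : ∑ t : V, (if t = s then 6 else 2) = 18 := by
    have : ∀ t : V, (if t = s then 6 else 2) = 2 + (if t = s then 4 else 0) := by
      intro t; split_ifs <;> rfl
    simp only [this, sum_add_distrib, sum_const, card_univ, hk, smul_eq_mul, sum_ite_eq', mem_univ,
      if_true]
  omega

/-- **CONFIGURATION β:** `y` in the first triangle, `x, z` off the first two, `m ≥ 11`: `Σ₀ ≥ 4`. -/
theorem beta_bound (D : SimpleGraph V) [DecidableRel D.Adj] (hK : K4mFree D) (hk : Fintype.card V = 7)
    (hm : 11 ≤ D.edgeFinset.card) {u v w a b c x y z : V} (huv : D.Adj u v) (huw : D.Adj u w)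
    (hvw : D.Adj v w) (hab : D.Adj a b) (hac : D.Adj a c) (hbc : D.Adj b c) (hxy : D.Adj x y)
    (hxz : D.Adj x z) (hyz : D.Adj y z) (hx1 : ¬ (x = u ∨ x = v ∨ x = w)) (hx2 : ¬ (x = a ∨ x = b ∨ x = c))
    (hz1 : ¬ (z = u ∨ z = v ∨ z = w)) (hz2 : ¬ (z = a ∨ z = b ∨ z = c)) (hy : y = u ∨ y = v ∨ y = w)
    (hne : ∃ t, (t = a ∨ t = b ∨ t = c) ∧ ¬ (t = u ∨ t = v ∨ t = w)) (hO2 : outer D a b c = ∅) :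
    4 ≤ ∑ p ∈ adjPairsAll D, (if codeg D p = 0 then deficit D p else 0) := by
  have hxz' := hxz.ne
  -- the first two triangles share a vertex
  obtain ⟨s, hs1, hs2⟩ : ∃ s, (s = u ∨ s = v ∨ s = w) ∧ (s = a ∨ s = b ∨ s = c) := by
    by_contra hsh
    have hT2T1 : ∀ t, (t = a ∨ t = b ∨ t = c) → ¬ (t = u ∨ t = v ∨ t = w) :=
      fun t h2 h1 => hsh ⟨t, h1, h2⟩
    have hau := hT2T1 a (by simp)
    have hbu := hT2T1 b (by simp)
    have hcu := hT2T1 c (by simp)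
    simp only [not_or] at hau hbu hcu hx1 hx2 hz1 hz2
    apply not_eight hk (v₁ := u) (v₂ := v) (v₃ := w) (v₄ := a) (v₅ := b) (v₆ := c) (v₇ := x) (v₈ := z)
    rw [card_insert_of_notMem, card_insert_of_notMem, card_insert_of_notMem, card_insert_of_notMem,
      card_insert_of_notMem, card_insert_of_notMem, card_insert_of_notMem, card_singleton]
    all_goals simp [huv.ne, huw.ne, hvw.ne, hab.ne, hac.ne, hbc.ne, hxz', Ne.symm hau.1,
      Ne.symm hau.2.1, Ne.symm hau.2.2, Ne.symm hbu.1, Ne.symm hbu.2.1, Ne.symm hbu.2.2, Ne.symm hcu.1,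
      Ne.symm hcu.2.1, Ne.symm hcu.2.2, Ne.symm hx1.1, Ne.symm hx1.2.1, Ne.symm hx1.2.2, Ne.symm hx2.1,
      Ne.symm hx2.2.1, Ne.symm hx2.2.2, Ne.symm hz1.1, Ne.symm hz1.2.1, Ne.symm hz1.2.2, Ne.symm hz2.1,
      Ne.symm hz2.2.1, Ne.symm hz2.2.2]
  have huniq : ∀ t, (t = u ∨ t = v ∨ t = w) → (t = a ∨ t = b ∨ t = c) → t = s := by
    intro t h1 h2
    by_contra hne'
    exact shared_unique D hK huv huw hvw hab hac hbc hne h1 h2 hs1 hs2 hne'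
  -- the two other vertices of the second triangle
  obtain ⟨q, q', hq, hq', hqq', hqs, hq's⟩ : ∃ q q', (q = a ∨ q = b ∨ q = c) ∧ (q' = a ∨ q' = b ∨ q' = c) ∧
      q ≠ q' ∧ q ≠ s ∧ q' ≠ s := by
    rcases hs2 with rfl | rfl | rfl
    · exact ⟨b, c, by simp, by simp, hbc.ne, hab.ne.symm, hac.ne.symm⟩
    · exact ⟨a, c, by simp, by simp, hac.ne, hab.ne, hbc.ne.symm⟩
    · exact ⟨a, b, by simp, by simp, hab.ne, hac.ne, hbc.ne⟩
  have hq1 : ¬ (q = u ∨ q = v ∨ q = w) := fun h => hqs (huniq q h hq)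
  have hq'1 : ¬ (q' = u ∨ q' = v ∨ q' = w) := fun h => hq's (huniq q' h hq')
  have hsq : D.Adj s q := adj_of_mem_triangle D hab hac hbc hs2 hq (Ne.symm hqs)
  have hsq' : D.Adj s q' := adj_of_mem_triangle D hab hac hbc hs2 hq' (Ne.symm hq's)
  have hqq'adj : D.Adj q q' := adj_of_mem_triangle D hab hac hbc hq hq' hqq'
  -- every vertex of the second triangle is `s`, `q` or `q′`
  have hT2 : ∀ t, (t = a ∨ t = b ∨ t = c) → t = s ∨ t = q ∨ t = q' := by
    intro t ht
    have h3 := three_of_three hs2 hq hq' (Ne.symm hqs) (Ne.symm hq's) hqq'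
    rcases ht with rfl | rfl | rfl
    · exact h3.1
    · exact h3.2.1
    · exact h3.2.2
  by_cases hys : y = s
  · -- three triangles through `s`: no room for the eleventh edge
    exfalso
    subst hys
    obtain ⟨p, p', hp, hp', hpp', hps, hp's⟩ : ∃ p p', (p = u ∨ p = v ∨ p = w) ∧ (p' = u ∨ p' = v ∨ p' = w) ∧
        p ≠ p' ∧ p ≠ y ∧ p' ≠ y := by
      rcases hs1 with rfl | rfl | rfl
      · exact ⟨v, w, by simp, by simp, hvw.ne, huv.ne.symm, huw.ne.symm⟩
      · exact ⟨u, w, by simp, by simp, huw.ne, huv.ne, hvw.ne.symm⟩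
      · exact ⟨u, v, by simp, by simp, huv.ne, huw.ne, hvw.ne⟩
    have hp2 : ¬ (p = a ∨ p = b ∨ p = c) := fun h => hps (huniq p hp h)
    have hp'2 : ¬ (p' = a ∨ p' = b ∨ p' = c) := fun h => hp's (huniq p' hp' h)
    have hsp : D.Adj y p := adj_of_mem_triangle D huv huw hvw hs1 hp (Ne.symm hps)
    have hsp' : D.Adj y p' := adj_of_mem_triangle D huv huw hvw hs1 hp' (Ne.symm hp's)
    have hpp'adj : D.Adj p p' := adj_of_mem_triangle D huv huw hvw hp hp' hpp'
    have hpq : p ≠ q := fun h => hp2 (h ▸ hq)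
    have hpq' : p ≠ q' := fun h => hp2 (h ▸ hq')
    have hp'q : p' ≠ q := fun h => hp'2 (h ▸ hq)
    have hp'q' : p' ≠ q' := fun h => hp'2 (h ▸ hq')
    have hpx : p ≠ x := fun h => hx1 (h ▸ hp)
    have hpz : p ≠ z := fun h => hz1 (h ▸ hp)
    have hp'x : p' ≠ x := fun h => hx1 (h ▸ hp')
    have hp'z : p' ≠ z := fun h => hz1 (h ▸ hp')
    have hqx : q ≠ x := fun h => hx2 (h ▸ hq)
    have hqz : q ≠ z := fun h => hz2 (h ▸ hq)
    have hq'x : q' ≠ x := fun h => hx2 (h ▸ hq')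
    have hq'z : q' ≠ z := fun h => hz2 (h ▸ hq')
    have h7 : ∀ t : V, t = y ∨ t = p ∨ t = p' ∨ t = q ∨ t = q' ∨ t = x ∨ t = z := by
      apply seven_mem hk
      rw [card_insert_of_notMem, card_insert_of_notMem, card_insert_of_notMem, card_insert_of_notMem,
        card_insert_of_notMem, card_insert_of_notMem, card_singleton]
      all_goals simp [hsp.ne, hsp'.ne, hpp', hsq.ne, hsq'.ne, hqq', hxy.ne.symm, hyz.ne, hxz', hpq, hpq',
        hp'q, hp'q', hpx, hpz, hp'x, hp'z, hqx, hqz, hq'x, hq'z]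
    have := no_edge_f3 D hK hk hsp hsp' hpp'adj hsq hsq' hqq'adj hxy.symm hyz hxz hpq hpq' hp'q hp'q' hpx hpz
      hp'x hp'z hqx hqz hq'x hq'z h7
    omega
  · -- the path of three triangles
    obtain ⟨p, hp, hps, hpy⟩ := third_vertex huv.ne huw.ne hvw.ne hs1 hy (Ne.symm hys)
    have hp2 : ¬ (p = a ∨ p = b ∨ p = c) := fun h => hps (huniq p hp h)
    have hy2 : ¬ (y = a ∨ y = b ∨ y = c) := fun h => hys (huniq y hy h)
    have hsy : D.Adj s y := adj_of_mem_triangle D huv huw hvw hs1 hy (Ne.symm hys)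
    have hsp : D.Adj s p := adj_of_mem_triangle D huv huw hvw hs1 hp (Ne.symm hps)
    have hyp : D.Adj y p := adj_of_mem_triangle D huv huw hvw hy hp (Ne.symm hpy)
    -- `x` and `z` are not adjacent to `s`
    have hxs : ¬ D.Adj x s := fun h =>
      not_adj_both D hK hsy hsp hyp (fun e => hx1 (by rw [← e]; exact hp)) h.symm hxy.symm
    have hzs : ¬ D.Adj z s := fun h =>
      not_adj_both D hK hsy hsp hyp (fun e => hz1 (by rw [← e]; exact hp)) h.symm hyz
    -- their neighbours in the second triangle lie in `{q, q′}`
    have nbr : ∀ r, ¬ (r = u ∨ r = v ∨ r = w) → ¬ (r = a ∨ r = b ∨ r = c) → ¬ D.Adj r s →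
        ∃ t, (t = q ∨ t = q') ∧ D.Adj r t := by
      intro r hr1 hr2 hrs
      have hrO : r ∉ outer D a b c := by rw [hO2]; exact notMem_empty r
      obtain ⟨t, ht, hrt⟩ : ∃ t, (t = a ∨ t = b ∨ t = c) ∧ D.Adj r t := by
        rcases adj_of_not_outer D hrO with h | h | h
        · exact ⟨a, by simp, h.symm⟩
        · exact ⟨b, by simp, h.symm⟩
        · exact ⟨c, by simp, h.symm⟩
      rcases hT2 t ht with rfl | rfl | rfl
      · exact (hrs hrt).elim
      · exact ⟨t, Or.inl rfl, hrt⟩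
      · exact ⟨t, Or.inr rfl, hrt⟩
    obtain ⟨t₂, ht₂, hxt₂⟩ := nbr x hx1 hx2 hxs
    obtain ⟨t₂', ht₂', hzt₂'⟩ := nbr z hz1 hz2 hzs
    have ht₂2 : t₂ = a ∨ t₂ = b ∨ t₂ = c := by rcases ht₂ with rfl | rfl <;> assumption
    have ht₂'2 : t₂' = a ∨ t₂' = b ∨ t₂' = c := by rcases ht₂' with rfl | rfl <;> assumption
    have ht₂1 : ¬ (t₂ = u ∨ t₂ = v ∨ t₂ = w) := by rcases ht₂ with rfl | rfl <;> assumption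
    have ht₂'1 : ¬ (t₂' = u ∨ t₂' = v ∨ t₂' = w) := by rcases ht₂' with rfl | rfl <;> assumption
    have ht₂s : D.Adj s t₂ := by rcases ht₂ with rfl | rfl <;> assumption
    have ht₂'s : D.Adj s t₂' := by rcases ht₂' with rfl | rfl <;> assumption
    -- `t₂` is off the third triangle
    have ht₂3 : ¬ (t₂ = x ∨ t₂ = y ∨ t₂ = z) := by
      rintro (h | h | h)
      · exact hx2 (h ▸ ht₂2)
      · exact hy2 (h ▸ ht₂2)
      · exact hz2 (h ▸ ht₂2)
    have ht₂'3 : ¬ (t₂' = x ∨ t₂' = y ∨ t₂' = z) := by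
      rintro (h | h | h)
      · exact hx2 (h ▸ ht₂'2)
      · exact hy2 (h ▸ ht₂'2)
      · exact hz2 (h ▸ ht₂'2)
    have htt : t₂ ≠ t₂' := by
      rintro rfl
      exact not_adj_two_of_triangle D hK hxy hxz hyz ht₂3 (by simp) (by simp) hxz' hxt₂.symm hzt₂'.symm
    -- the seven vertices
    have h7 : ∀ t : V, t = s ∨ t = y ∨ t = p ∨ t = q ∨ t = q' ∨ t = x ∨ t = z := by
      apply seven_mem hk
      have hpq : p ≠ q := fun h => hp2 (h ▸ hq)
      have hpq' : p ≠ q' := fun h => hp2 (h ▸ hq')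
      have hyq : y ≠ q := fun h => hy2 (h ▸ hq)
      have hyq' : y ≠ q' := fun h => hy2 (h ▸ hq')
      have hpx : p ≠ x := fun h => hx1 (h ▸ hp)
      have hpz : p ≠ z := fun h => hz1 (h ▸ hp)
      have hqx : q ≠ x := fun h => hx2 (h ▸ hq)
      have hqz : q ≠ z := fun h => hz2 (h ▸ hq)
      have hq'x : q' ≠ x := fun h => hx2 (h ▸ hq')
      have hq'z : q' ≠ z := fun h => hz2 (h ▸ hq')
      have hsx : s ≠ x := fun h => hx1 (h ▸ hs1)
      have hsz : s ≠ z := fun h => hz1 (h ▸ hs1)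
      rw [card_insert_of_notMem, card_insert_of_notMem, card_insert_of_notMem, card_insert_of_notMem,
        card_insert_of_notMem, card_insert_of_notMem, card_singleton]
      all_goals simp [hsy.ne, hsp.ne, hyp.ne, hsq.ne, hsq'.ne, hqq', hxy.ne.symm, hyz.ne, hxz', hpq, hpq',
        hyq, hyq', hpx, hpz, hqx, hqz, hq'x, hq'z, hsx, hsz]
    -- the far pair at `x` (and at `z`)
    have step : ∀ r t, ¬ (r = u ∨ r = v ∨ r = w) → ¬ (r = a ∨ r = b ∨ r = c) → ¬ D.Adj r s →
        (t = q ∨ t = q') → D.Adj r t → (r = x ∨ r = z) →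
        codeg D (r, t) = 0 ∧ 1 ≤ deficit D (r, t) := by
      intro r t hr1 hr2 hrs ht hrt hrxz
      have ht2 : t = a ∨ t = b ∨ t = c := by rcases ht with rfl | rfl <;> assumption
      have ht1 : ¬ (t = u ∨ t = v ∨ t = w) := by rcases ht with rfl | rfl <;> assumption
      have hts : D.Adj s t := by rcases ht with rfl | rfl <;> assumption
      have ht3 : ¬ (t = x ∨ t = y ∨ t = z) := by
        rintro (h | h | h)
        · exact hx2 (h ▸ ht2)
        · exact hy2 (h ▸ ht2)
        · exact hz2 (h ▸ ht2)
      have hrp : ¬ D.Adj r p := by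
        intro h
        rcases hrxz with rfl | rfl
        · exact not_adj_two_of_triangle D hK huv huw hvw hr1 hy hp (Ne.symm hpy) hxy h
        · exact not_adj_two_of_triangle D hK huv huw hvw hr1 hy hp (Ne.symm hpy) hyz.symm h
      have htp : ¬ D.Adj t p := fun h =>
        not_adj_two_of_triangle D hK huv huw hvw ht1 hs1 hp (Ne.symm hps) hts.symm h
      refine ⟨?_, one_le_deficit D hrp htp⟩
      unfold codeg
      rw [card_eq_zero, filter_eq_empty_iff]
      intro w' _ hw'
      have h1 : D.Adj r w' := hw'.1
      have h2 : D.Adj t w' := hw'.2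
      rcases h7 w' with rfl | rfl | rfl | rfl | rfl | rfl | rfl
      · exact hrs h1
      · exact not_adj_two_of_triangle D hK huv huw hvw ht1 hs1 hy (Ne.symm hys) hts.symm h2
      · exact htp h2
      · rcases ht with rfl | rfl
        · exact h2.ne rfl
        · exact not_adj_two_of_triangle D hK hab hac hbc hr2 ht2 hq hqq'.symm hrt h1
      · rcases ht with rfl | rfl
        · exact not_adj_two_of_triangle D hK hab hac hbc hr2 ht2 hq' hqq' hrt h1
        · exact h2.ne rfl
      · rcases hrxz with rfl | rfl
        · exact h1.ne rfl
        · exact not_adj_two_of_triangle D hK hxy hxz hyz ht3 (by simp) (by simp) hxz'.symm hrt.symm h2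
      · rcases hrxz with rfl | rfl
        · exact not_adj_two_of_triangle D hK hxy hxz hyz ht3 (by simp) (by simp) hxz' hrt.symm h2
        · exact h1.ne rfl
    obtain ⟨hc₁, hd₁⟩ := step x t₂ hx1 hx2 hxs ht₂ hxt₂ (Or.inl rfl)
    obtain ⟨hc₂, hd₂⟩ := step z t₂' hz1 hz2 hzs ht₂' hzt₂' (Or.inr rfl)
    exact four_le_sum_codeg_zero_pairs D hxz' (fun h => hx2 (h ▸ ht₂'2)) (fun h => hz2 (h.symm ▸ ht₂2)) htt
      hxt₂ hzt₂' hc₁ hc₂ hd₁ hd₂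

end C047

end TriangleCap

end PercRepro
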